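import Mathlib
import Literature.NumberTheory.Transcendental.AxSchanuel
import Literature.NumberTheory.Transcendental.RosenlichtProp4Residues
import Literature.NumberTheory.Transcendental.AxSchanuelUniv
import Literature.NumberTheory.Transcendental.AxSchanuelTwoGerms
import Literature.NumberTheory.Transcendental.AxSchanuelWeierstrass
import Literature.Analysis.Complex.LaurentExpansionGerms
import Literature.Analysis.Complex.LaurentExpansionEval
import Literature.RingTheory.PowerSeries.LaurentSeriesConstants
import Literature.FieldTheory.TranscendenceDegree.AlgebraicDependenceBookkeeping

/-!
# Crux `TateFamilyKernel` (stmt-KontsevichZagierPeriods-9130), line `Sketch` — `stub_logIndepGerms`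

LINEAR INDEPENDENCE OF LOGARITHMS OF ALGEBRAIC GERMS over the algebraic germs, the uniform
elimination engine "`Σ (algebraic coefficient)·log(algebraic function) ≡ 0 ⇒ coefficients vanish`"
of the lead's skeleton of the crux
`Summit.KontsevichZagierPeriods.KontsevichZagierPeriods.Theses.InverseLandau.TateFamilyKernel`,
derived from Ax's theorem (Ax 1971, Thm. 3), which the tree PROVES
(`Literature.NumberTheory.Transcendental.ax_schanuel_holds`; we use its universe-polymorphic,
base-field form `Literature.NumberTheory.Transcendental.Ax1971.add_rank_le_trdeg_of_field`).

**Statement** (`stub_logIndepGerms`). Let `f₁, …, fₙ` be germs at `0` of analytic functions with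
analytic logarithms `ℓᵢ` (`exp ∘ ℓᵢ = fᵢ` near `0`), algebraic over `ℂ(z)`, and such that no
non-trivial integer combination `Σ qᵢ ℓᵢ` is constant near `0`. If `a₀ + Σ aᵢ ℓᵢ = 0` near `0`
with `a₀, aᵢ` analytic germs algebraic over `ℂ(z)`, then every `aᵢ` vanishes near `0`.

**Proof.** Work in the differential field `K = ℂ⸨X⸩` with `D = d/dX` (constants `ℂ`,
`LaurentSeriesConstants.lean`), and Taylor expansions `yᵢ = ℓ̂ᵢ`, `zᵢ = (e^{ℓᵢ})^`, `Aᵢ = âᵢ`,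
`A₀ = â₀`, `X = ẑ` (`Literature.Analysis.Complex.LaurentGerm`). The exponential relations
`D zᵢ = zᵢ D yᵢ` hold (`derivative_taylor_exp`), the `yᵢ` are `ℚ`-independent modulo constants
(a constant Taylor series is a constant germ), and `D y_j ≠ 0`, so Ax gives
`trdeg_ℂ ℂ[y, z] ≥ n + 1`. On the other hand `zᵢ, Aᵢ, A₀` are algebraic over `ℂ[X]`
(`aeval_laurent_eq_zero`), and if some `A_j ≠ 0` the relation `A₀ + Σ Aᵢ yᵢ = 0` makes `y_j`
algebraic over `ℂ[X, (yᵢ)_{i ≠ j}, A, A₀]`, whence (matroid of algebraic independence,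
`AlgebraicDependenceBookkeeping.lean`) everything is algebraic over `ℂ[X, (yᵢ)_{i ≠ j}]` and
`trdeg ≤ n` — contradiction. Hence all `A_j = 0`, i.e. `a_j ≡ 0` near `0`.

Mathlib + landed Literature files only; no named fact, no new definition.
-/

noncomputable section

open MeasureTheory Set MvPolynomial
open Literature.NumberTheory.Transcendental
open scoped Topology

namespace Summit.KontsevichZagierPeriods.InverseLandau.TateFamilyKernel.Descent

namespace LogIndepGerms

open Filter HahnSeries
open Literature.NumberTheory.Transcendental.AndreCriterion (taylor_add taylor_const_mul taylor_mul)
open Literature.Analysis.Complex.FormalRoot (taylor_eq_zero_iff eventuallyEq_of_taylor_eq)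
open Literature.Analysis.Complex.LaurentGerm (laurent_id laurent_of_analyticAt
  aeval_laurent_eq_zero derivative_taylor_exp)
open Literature.RingTheory.PowerSeries (derivative_eq_zero_iff_mem_range_algebraMap
  algebraMap_laurentSeries_apply)
open Literature.FieldTheory.TranscendenceDegree (mem_closure_iff_isAlgebraic
  isAlgebraic_adjoin_singleton_of_aeval_eq_zero trdeg_le_card_of_forall_isAlgebraic
  transcendental_of_not_mem_range)
open Literature.NumberTheory.Transcendental.AxTwoGerms (exists_algDerivation_eq_derivative
  ofPowerSeries_taylor_exp_ne_zero algebraMap_eq_ofPowerSeries_C taylor_const)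

/-! ### Transcendence-degree bookkeeping -/

/-- **Bookkeeping.** In a field extension `K / F`, let `zᵢ, Aᵢ, A₀` be algebraic over `F[x]` and
`A₀ + Σ Aᵢ yᵢ = 0` with some `A_j ≠ 0`. Then `trdeg_F F[y, z] ≤ n`: everything is algebraic over
`F[x, (yᵢ)_{i ≠ j}]` (matroid of algebraic independence). [folklore] -/
theorem trdeg_adjoin_le_of_linear_relation {F K : Type*} [Field F] [Field K] [Algebra F K]
    {n : ℕ} (x A₀ : K) (y z A : Fin n → K)
    (hz : ∀ i, IsAlgebraic (Algebra.adjoin F ({x} : Set K)) (z i))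
    (hA : ∀ i, IsAlgebraic (Algebra.adjoin F ({x} : Set K)) (A i))
    (hA₀ : IsAlgebraic (Algebra.adjoin F ({x} : Set K)) A₀)
    (hrel : A₀ + ∑ i, A i * y i = 0) {j : Fin n} (hj : A j ≠ 0) :
    Algebra.trdeg F (Algebra.adjoin F (range y ∪ range z)) ≤ (n : Cardinal) := by
  classical
  set M := AlgebraicIndependent.matroid F K with hM
  set S : Finset K := insert x ((Finset.univ.erase j).image y) with hS
  have hcard : S.card ≤ n := by
    calc S.card ≤ ((Finset.univ.erase j).image y).card + 1 := Finset.card_insert_le _ _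
      _ ≤ (Finset.univ.erase j).card + 1 := by gcongr; exact Finset.card_image_le
      _ = n := by
          rw [Finset.card_erase_of_mem (Finset.mem_univ j), Finset.card_univ, Fintype.card_fin]
          have := j.pos; omega
  have hE : ∀ s : Set K, s ⊆ M.E := fun s => by simp [hM]
  -- `cl {x} ⊆ cl S`
  have hxS : ({x} : Set K) ⊆ (S : Set K) := by
    rw [Set.singleton_subset_iff, hS, Finset.coe_insert]
    exact Set.mem_insert _ _
  have hclx : M.closure {x} ⊆ M.closure S := M.closure_subset_closure hxS
  have hmemx : ∀ {u : K}, IsAlgebraic (Algebra.adjoin F ({x} : Set K)) u → u ∈ M.closure S :=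
    fun hu => hclx ((mem_closure_iff_isAlgebraic _ _).2 hu)
  have hyS : ∀ i, i ≠ j → y i ∈ M.closure S := fun i hi =>
    M.mem_closure_of_mem (by
      rw [hS, Finset.coe_insert]
      refine Set.mem_insert_of_mem _ ?_
      rw [Finset.coe_image]
      exact ⟨i, by simp [hi], rfl⟩) (hE _)
  -- `y j ∈ cl S`, by the relation
  have hyj : y j ∈ M.closure S := by
    rw [← M.closure_closure, mem_closure_iff_isAlgebraic]
    set R := Algebra.adjoin F (M.closure (S : Set K)) with hR
    have hAj : A j ∈ R := Algebra.subset_adjoin (hmemx (hA j))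
    set N : K := A₀ + ∑ i ∈ Finset.univ.erase j, A i * y i with hN
    have hNR : N ∈ R := by
      refine add_mem (Algebra.subset_adjoin (hmemx hA₀)) (sum_mem fun i hi => ?_)
      exact mul_mem (Algebra.subset_adjoin (hmemx (hA i)))
        (Algebra.subset_adjoin (hyS i (Finset.ne_of_mem_erase hi)))
    have hlin : A j * y j + N = 0 := by
      rw [← hrel, hN, ← Finset.add_sum_erase Finset.univ (fun i => A i * y i) (Finset.mem_univ j)]
      ring
    refine ⟨Polynomial.C (⟨A j, hAj⟩ : R) * Polynomial.X + Polynomial.C (⟨N, hNR⟩ : R), ?_, ?_⟩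
    · intro h0
      have := congrArg (fun p : Polynomial R => ((p.coeff 1 : R) : K)) h0
      simp at this
      exact hj this
    · simp only [map_add, map_mul, Polynomial.aeval_C, Polynomial.aeval_X]
      exact hlin
  -- everything is algebraic over `F[S]`
  have hall : ∀ u ∈ range y ∪ range z, IsAlgebraic (Algebra.adjoin F (S : Set K)) u := by
    rintro u (⟨i, rfl⟩ | ⟨i, rfl⟩)
    · rw [← mem_closure_iff_isAlgebraic]
      by_cases hi : i = j
      · subst hi; exact hyj
      · exact hyS i hi
    · rw [← mem_closure_iff_isAlgebraic]
      exact hmemx (hz i)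
  haveI : IsDomain (Algebra.adjoin F (S : Set K)) := inferInstance
  have hgen : range y ∪ range z ⊆
      ((Subalgebra.algebraicClosure (Algebra.adjoin F (S : Set K)) K).restrictScalars F :
        Subalgebra F K) := fun u hu => hall u hu
  have hle := Algebra.adjoin_le hgen
  exact (trdeg_le_card_of_forall_isAlgebraic _ S fun a ha => hle ha).trans (by exact_mod_cast hcard)

/-! ### Taylor expansions of germs -/

/-- Taylor series of a finite sum of analytic germs. [folklore] -/
theorem taylor_finsum {ι : Type*} (s : Finset ι) {F : ι → ℂ → ℂ}
    (h : ∀ i ∈ s, AnalyticAt ℂ (F i) 0) :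
    (PowerSeries.mk fun n => ((Nat.factorial n : ℂ)⁻¹ *
        iteratedDeriv n (fun z => ∑ i ∈ s, F i z) 0) : PowerSeries ℂ) =
      ∑ i ∈ s, (PowerSeries.mk fun n => ((Nat.factorial n : ℂ)⁻¹ * iteratedDeriv n (F i) 0) :
        PowerSeries ℂ) := by
  classical
  induction s using Finset.induction_on with
  | empty =>
    simp only [Finset.sum_empty]
    have h0 := taylor_const (0 : ℂ)
    rw [map_zero] at h0
    exact h0
  | insert a s ha ih =>
    have hs : ∀ i ∈ s, AnalyticAt ℂ (F i) 0 := fun i hi => h i (Finset.mem_insert_of_mem hi)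
    have hfun : (fun z : ℂ => ∑ i ∈ insert a s, F i z) = F a + fun z => ∑ i ∈ s, F i z := by
      funext z
      rw [Finset.sum_insert ha]
      rfl
    rw [hfun, taylor_add (h a (Finset.mem_insert_self a s)) (Finset.analyticAt_fun_sum s hs),
      ih hs, Finset.sum_insert ha]

/-- **The relation passes to Taylor series**: `â₀ + Σ âᵢ ℓ̂ᵢ = 0` in `ℂ⸨X⸩`. [folklore] -/
theorem rel_taylor {n : ℕ} {ℓ a : Fin n → ℂ → ℂ} {a₀ : ℂ → ℂ} (hℓ : ∀ i, AnalyticAt ℂ (ℓ i) 0)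
    (ha : ∀ i, AnalyticAt ℂ (a i) 0) (ha₀ : AnalyticAt ℂ a₀ 0)
    (hrel : ∀ᶠ z in 𝓝 (0 : ℂ), a₀ z + ∑ i, a i z * ℓ i z = 0) :
    ofPowerSeries ℤ ℂ (PowerSeries.mk fun n => ((Nat.factorial n : ℂ)⁻¹ * iteratedDeriv n a₀ 0)) +
      ∑ i, ofPowerSeries ℤ ℂ
          (PowerSeries.mk fun n => ((Nat.factorial n : ℂ)⁻¹ * iteratedDeriv n (a i) 0)) *
        ofPowerSeries ℤ ℂ
          (PowerSeries.mk fun n => ((Nat.factorial n : ℂ)⁻¹ * iteratedDeriv n (ℓ i) 0)) =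
      (0 : LaurentSeries ℂ) := by
  have hsum : AnalyticAt ℂ (fun z => ∑ i, a i z * ℓ i z) 0 :=
    Finset.analyticAt_fun_sum _ fun i _ => (ha i).mul (hℓ i)
  have han : AnalyticAt ℂ (fun z => a₀ z + ∑ i, a i z * ℓ i z) 0 := ha₀.add hsum
  have h0 : (PowerSeries.mk fun n => ((Nat.factorial n : ℂ)⁻¹ *
      iteratedDeriv n (fun z => a₀ z + ∑ i, a i z * ℓ i z) 0) : PowerSeries ℂ) = 0 :=
    (taylor_eq_zero_iff han).2 hrel
  have hfun : (fun z => a₀ z + ∑ i, a i z * ℓ i z) = a₀ + fun z => ∑ i, a i z * ℓ i z := rfl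
  have hmul : ∀ i, (PowerSeries.mk fun n => ((Nat.factorial n : ℂ)⁻¹ *
      iteratedDeriv n (fun z => a i z * ℓ i z) 0) : PowerSeries ℂ) =
      (PowerSeries.mk fun n => ((Nat.factorial n : ℂ)⁻¹ * iteratedDeriv n (a i) 0)) *
        PowerSeries.mk fun n => ((Nat.factorial n : ℂ)⁻¹ * iteratedDeriv n (ℓ i) 0) :=
    fun i => taylor_mul (ha i) (hℓ i)
  rw [hfun, taylor_add ha₀ hsum,
    taylor_finsum (F := fun i z => a i z * ℓ i z) _ (fun i _ => (ha i).mul (hℓ i))] at h0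
  simp only [hmul] at h0
  have := congrArg (ofPowerSeries ℤ ℂ) h0
  simpa only [map_add, map_sum, map_mul, map_zero] using this

/-- **Integer combinations with constant derivative are constant germs**: if
`d/dX (Σ qᵢ ℓ̂ᵢ) = 0` in `ℂ⸨X⸩` then `Σ qᵢ ℓᵢ` is constant near `0`. [folklore] -/
theorem exists_const_of_derivative_eq_zero {n : ℕ} {ℓ : Fin n → ℂ → ℂ}
    (hℓ : ∀ i, AnalyticAt ℂ (ℓ i) 0) (q : Fin n → ℤ)
    (h : LaurentSeries.derivative ℂ (∑ i, (q i : LaurentSeries ℂ) * ofPowerSeries ℤ ℂ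
      (PowerSeries.mk fun n => ((Nat.factorial n : ℂ)⁻¹ * iteratedDeriv n (ℓ i) 0))) = 0) :
    ∃ c : ℂ, ∀ᶠ z in 𝓝 (0 : ℂ), ∑ i, (q i : ℂ) * ℓ i z = c := by
  have han : ∀ i, AnalyticAt ℂ (fun w => (q i : ℂ) * ℓ i w) 0 := fun i =>
    analyticAt_const.mul (hℓ i)
  have hanS : AnalyticAt ℂ (fun w => ∑ i, (q i : ℂ) * ℓ i w) 0 :=
    Finset.analyticAt_fun_sum _ fun i _ => han i
  have hsum : (∑ i, (q i : LaurentSeries ℂ) * ofPowerSeries ℤ ℂ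
      (PowerSeries.mk fun n => ((Nat.factorial n : ℂ)⁻¹ * iteratedDeriv n (ℓ i) 0))) =
      ofPowerSeries ℤ ℂ (PowerSeries.mk fun m => ((Nat.factorial m : ℂ)⁻¹ *
        iteratedDeriv m (fun w => ∑ i, (q i : ℂ) * ℓ i w) 0)) := by
    rw [taylor_finsum _ (fun i _ => han i), map_sum]
    refine Finset.sum_congr rfl fun i _ => ?_
    rw [taylor_const_mul, map_mul, ofPowerSeries_C,
      ← map_intCast (HahnSeries.C : ℂ →+* LaurentSeries ℂ) (q i)]
  rw [hsum, derivative_eq_zero_iff_mem_range_algebraMap] at h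
  obtain ⟨c, hc⟩ := h
  rw [algebraMap_eq_ofPowerSeries_C] at hc
  have hc' := ofPowerSeries_injective hc
  rw [← taylor_const] at hc'
  exact ⟨c, (eventuallyEq_of_taylor_eq analyticAt_const hanS hc').symm.mono fun w hw => hw⟩

/-! ### Algebraicity over `ℂ[X]` passes to Taylor series -/

/-- `X ∈ ℂ⸨X⸩` is transcendental over `ℂ`. [folklore] -/
theorem transcendental_single :
    Transcendental ℂ (single (1 : ℤ) (1 : ℂ) : LaurentSeries ℂ) := by
  refine transcendental_of_not_mem_range ?_
  rintro ⟨c, hc⟩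
  rw [algebraMap_laurentSeries_apply] at hc
  have := congrArg (fun s : LaurentSeries ℂ => s.coeff 1) hc
  simp at this

/-- Evaluation of a bivariate polynomial through `Polynomial.Bivariate.equivMvPolynomial`:
`(equiv P)(z, w) = P(z)(w)`. [folklore] -/
theorem eval_equivMvPolynomial (P : Polynomial (Polynomial ℂ)) (z w : ℂ) :
    MvPolynomial.eval ![z, w] (Polynomial.Bivariate.equivMvPolynomial ℂ P) =
      (P.map (Polynomial.evalRingHom z)).eval w := by
  rw [Polynomial.map_evalRingHom_eval, ← Polynomial.coe_aevalAeval_eq_evalEval]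
  have key : (MvPolynomial.aeval ![z, w]).comp
      (Polynomial.Bivariate.equivMvPolynomial ℂ :
        Polynomial (Polynomial ℂ) →ₐ[ℂ] MvPolynomial (Fin 2) ℂ) =
      Polynomial.aevalAeval z w := by
    refine Polynomial.algHom_ext' (Polynomial.algHom_ext ?_) ?_
    · simp
    · simp
  have := congrArg (fun φ => φ P) key
  simpa using this

/-- **Algebraic germs have algebraic Taylor series.** If `P(z, g(z)) = 0` near `0` for a
non-zero `P ∈ ℂ[z][Y]` and `g` analytic at `0`, then `ĝ ∈ ℂ⸨X⸩` is algebraic over `ℂ[X]`.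
[folklore] -/
theorem isAlgebraic_taylor {g : ℂ → ℂ} (hg : AnalyticAt ℂ g 0) {P : Polynomial (Polynomial ℂ)}
    (hP : P ≠ 0) (h : ∀ᶠ z in 𝓝 (0 : ℂ), (P.map (Polynomial.evalRingHom z)).eval (g z) = 0) :
    IsAlgebraic (Algebra.adjoin ℂ ({single (1 : ℤ) (1 : ℂ)} : Set (LaurentSeries ℂ)))
      (ofPowerSeries ℤ ℂ
        (PowerSeries.mk fun n => ((Nat.factorial n : ℂ)⁻¹ * iteratedDeriv n g 0))) := by
  set Q := Polynomial.Bivariate.equivMvPolynomial ℂ P with hQ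
  have hQ0 : Q ≠ 0 := by
    rw [hQ]
    exact (map_ne_zero_iff _ (Polynomial.Bivariate.equivMvPolynomial ℂ).injective).2 hP
  have hf : AnalyticAt ℂ (fun z : ℂ => z ^ (0 : ℕ) * (fun z : ℂ => z) z) 0 := by
    simp only [pow_zero, one_mul]
    exact analyticAt_id
  have hg' : AnalyticAt ℂ (fun z : ℂ => z ^ (0 : ℕ) * g z) 0 := by simpa using hg
  have h' : ∀ᶠ z in 𝓝[≠] (0 : ℂ), MvPolynomial.eval ![(fun z : ℂ => z) z, g z] Q = 0 := by
    refine eventually_nhdsWithin_of_eventually_nhds (h.mono fun z hz => ?_)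
    rw [hQ, eval_equivMvPolynomial]
    exact hz
  have key := aeval_laurent_eq_zero (f := fun z : ℂ => z) (g := g) (n := 0) (m := 0) hf hg' Q h'
  rw [laurent_id, laurent_of_analyticAt] at key
  exact isAlgebraic_adjoin_singleton_of_aeval_eq_zero hQ0 key transcendental_single

end LogIndepGerms

open Filter HahnSeries LogIndepGerms
open Literature.Analysis.Complex.FormalRoot (taylor_eq_zero_iff)
open Literature.Analysis.Complex.LaurentGerm (derivative_taylor_exp)
open Literature.RingTheory.PowerSeries (derivative_eq_zero_iff_mem_range_algebraMap)
open Literature.NumberTheory.Transcendental.AxTwoGerms (exists_algDerivation_eq_derivative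
  ofPowerSeries_taylor_exp_ne_zero)

/-- STUB `stub_logIndepGerms` (TOOL for target T1: **linear independence of logarithms of
algebraic germs over the algebraic germs**, from Ax's theorem, PROVED in the tree as
`Literature.NumberTheory.Transcendental.ax_schanuel_holds` /
`Literature.NumberTheory.Transcendental.Ax1971.add_rank_le_trdeg_of_field`). Let `f₁,…,fₙ` be
germs at `0` of analytic functions, algebraic over `ℂ(z)`, with analytic logarithms `ℓᵢ`
(`exp ∘ ℓᵢ = fᵢ` near `0`), such that no non-trivial integer combination `Σ qᵢ ℓᵢ` is constant
near `0`. If `a₀ + Σ aᵢ·ℓᵢ = 0` near `0` with `a₀, aᵢ` analytic germs algebraic over `ℂ(z)`, then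
every `aᵢ` vanishes near `0`. Proof: in `K = ℂ⸨X⸩` with `D = d/dX` (constants `ℂ`) and the
Taylor expansions `yᵢ = ℓ̂ᵢ`, `zᵢ = (e^{ℓᵢ})^`, Ax gives `trdeg_ℂ ℂ[y, z] ≥ n + 1`, while a
relation with some `âⱼ ≠ 0` makes everything algebraic over `ℂ[X, (yᵢ)_{i ≠ j}]`, of
transcendence degree `≤ n` (`LogIndepGerms.trdeg_adjoin_le_of_linear_relation`).
[cite: Ax1971, Thm. 3 and Cor. 1] -/
theorem stub_logIndepGerms (n : ℕ) (f ℓ a : Fin n → ℂ → ℂ) (a₀ : ℂ → ℂ)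
    (hf : ∀ i, AnalyticAt ℂ (f i) 0) (hℓ : ∀ i, AnalyticAt ℂ (ℓ i) 0)
    (hexp : ∀ i, ∀ᶠ z in nhds (0 : ℂ), Complex.exp (ℓ i z) = f i z)
    (ha : ∀ i, AnalyticAt ℂ (a i) 0) (ha₀ : AnalyticAt ℂ a₀ 0)
    (hfalg : ∀ i, ∃ P : Polynomial (Polynomial ℂ), P ≠ 0 ∧
      ∀ᶠ z in nhds (0 : ℂ), (P.map (Polynomial.evalRingHom z)).eval (f i z) = 0)
    (haalg : ∀ i, ∃ P : Polynomial (Polynomial ℂ), P ≠ 0 ∧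
      ∀ᶠ z in nhds (0 : ℂ), (P.map (Polynomial.evalRingHom z)).eval (a i z) = 0)
    (ha₀alg : ∃ P : Polynomial (Polynomial ℂ), P ≠ 0 ∧
      ∀ᶠ z in nhds (0 : ℂ), (P.map (Polynomial.evalRingHom z)).eval (a₀ z) = 0)
    (hind : ∀ q : Fin n → ℤ, q ≠ 0 →
      ¬ ∃ c : ℂ, ∀ᶠ z in nhds (0 : ℂ), ∑ i, (q i : ℂ) * ℓ i z = c)
    (hrel : ∀ᶠ z in nhds (0 : ℂ), a₀ z + ∑ i, a i z * ℓ i z = 0) :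
    ∀ i, ∀ᶠ z in nhds (0 : ℂ), a i z = 0 := by
  classical
  have _ := hf
  intro j
  by_contra hj
  haveI : CharZero (LaurentSeries ℂ) :=
    charZero_of_injective_algebraMap (algebraMap ℂ (LaurentSeries ℂ)).injective
  obtain ⟨D, hD⟩ := exists_algDerivation_eq_derivative
  -- Taylor expansions in `K = ℂ⸨X⸩`
  obtain ⟨y, hy⟩ : ∃ y : Fin n → LaurentSeries ℂ, ∀ i, y i = ofPowerSeries ℤ ℂ
      (PowerSeries.mk fun m => ((Nat.factorial m : ℂ)⁻¹ * iteratedDeriv m (ℓ i) 0)) :=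
    ⟨_, fun _ => rfl⟩
  obtain ⟨z, hz⟩ : ∃ z : Fin n → LaurentSeries ℂ, ∀ i, z i = ofPowerSeries ℤ ℂ
      (PowerSeries.mk fun m => ((Nat.factorial m : ℂ)⁻¹ *
        iteratedDeriv m (fun w => Complex.exp (ℓ i w)) 0)) :=
    ⟨_, fun _ => rfl⟩
  obtain ⟨A, hA⟩ : ∃ A : Fin n → LaurentSeries ℂ, ∀ i, A i = ofPowerSeries ℤ ℂ
      (PowerSeries.mk fun m => ((Nat.factorial m : ℂ)⁻¹ * iteratedDeriv m (a i) 0)) :=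
    ⟨_, fun _ => rfl⟩
  set A₀ : LaurentSeries ℂ := ofPowerSeries ℤ ℂ
    (PowerSeries.mk fun m => ((Nat.factorial m : ℂ)⁻¹ * iteratedDeriv m a₀ 0)) with hA₀
  set Dv : Fin 1 → @Derivation ℂ (LaurentSeries ℂ) (LaurentSeries ℂ) _ _ _ _ _ Algebra.toModule :=
    fun _ => D with hDv
  -- constants of `d/dX` are `ℂ`
  have hC : ∀ x : LaurentSeries ℂ, (∀ k, Dv k x = 0) →
      x ∈ Set.range (algebraMap ℂ (LaurentSeries ℂ)) := fun x hx =>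
    (derivative_eq_zero_iff_mem_range_algebraMap x).1 (by rw [← hD]; exact hx 0)
  -- the exponential relations
  have hzne : ∀ i, z i ≠ 0 := fun i => by rw [hz]; exact ofPowerSeries_taylor_exp_ne_zero (ℓ i)
  have hexp' : ∀ k i, Dv k (z i) = z i * Dv k (y i) := fun k i => by
    simp only [hDv, hD, hz, hy]
    exact derivative_taylor_exp (hℓ i)
  -- `ℚ`-linear independence modulo constants
  have hind' : ∀ q : Fin n → ℤ, (∀ k, Dv k (∑ i, (q i : LaurentSeries ℂ) * y i) = 0) → q = 0 := by
    intro q hq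
    by_contra hq0
    refine hind q hq0 (exists_const_of_derivative_eq_zero hℓ q ?_)
    have := hq 0
    simp only [hDv, hD, hy] at this
    exact this
  -- `A j ≠ 0`
  have hAj : A j ≠ 0 := by
    intro h0
    rw [hA, map_eq_zero_iff _ ofPowerSeries_injective, taylor_eq_zero_iff (ha j)] at h0
    exact hj h0
  -- `D y_j ≠ 0`, so the rank term is `≥ 1`
  have hDy : D (y j) ≠ 0 := by
    intro h0
    have hq := hind' (Pi.single j 1) (fun k => by
      have hs : (∑ i, ((Pi.single j (1 : ℤ) : Fin n → ℤ) i : LaurentSeries ℂ) * y i) = y j := by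
        rw [Finset.sum_eq_single j]
        · simp
        · intro b _ hb; simp [hb]
        · intro hj'; exact absurd (Finset.mem_univ j) hj'
      rw [hs]; exact h0)
    have := congrFun hq j
    simp at this
  have hrank : 1 ≤ (Matrix.of fun i k => Dv k (y i)).rank := by
    rw [← Matrix.rank_transpose]
    exact one_le_rank_of_ne_zero (fun k i => Dv k (y i)) (j₀ := j) hDy
  -- Ax: `n + 1 ≤ trdeg`
  have hax := Ax1971.add_rank_le_trdeg_of_field (k := ℂ) (K := LaurentSeries ℂ) (m := 1) (n := n)
    Dv hC y z hzne hexp' hind'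
  have hlow : ((n + 1 : ℕ) : Cardinal) ≤
      Algebra.trdeg ℂ (Algebra.adjoin ℂ (Set.range y ∪ Set.range z)) := by
    refine le_trans ?_ hax
    exact_mod_cast Nat.add_le_add_left hrank n
  -- everything is algebraic over `ℂ[X]`; the relation
  have hzalg : ∀ i, IsAlgebraic
      (Algebra.adjoin ℂ ({single (1 : ℤ) (1 : ℂ)} : Set (LaurentSeries ℂ))) (z i) := by
    intro i
    obtain ⟨P, hP, hPz⟩ := hfalg i
    rw [hz]
    refine isAlgebraic_taylor (analyticAt_cexp.comp (hℓ i)) hP ?_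
    filter_upwards [hPz, hexp i] with w h1 h2
    rwa [h2]
  have hAalg : ∀ i, IsAlgebraic
      (Algebra.adjoin ℂ ({single (1 : ℤ) (1 : ℂ)} : Set (LaurentSeries ℂ))) (A i) := by
    intro i
    obtain ⟨P, hP, hPz⟩ := haalg i
    rw [hA]
    exact isAlgebraic_taylor (ha i) hP hPz
  have hA₀alg : IsAlgebraic
      (Algebra.adjoin ℂ ({single (1 : ℤ) (1 : ℂ)} : Set (LaurentSeries ℂ))) A₀ := by
    obtain ⟨P, hP, hPz⟩ := ha₀alg
    exact isAlgebraic_taylor ha₀ hP hPz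
  have hrelK : A₀ + ∑ i, A i * y i = 0 := by
    have := rel_taylor hℓ ha ha₀ hrel
    simpa only [← hy, ← hA] using this
  have hup := trdeg_adjoin_le_of_linear_relation (F := ℂ) (single (1 : ℤ) (1 : ℂ)) A₀ y z A
    hzalg hAalg hA₀alg hrelK hAj
  have := hlow.trans hup
  norm_cast at this; omega

end Summit.KontsevichZagierPeriods.InverseLandau.TateFamilyKernel.Descent

end
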